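import Summits.CriticalPhenomena.PercolationContinuityZ3.Theorems.PercNearOneGluingNoHeavyLowerTailSahiCoSunflowerCylinder
import Mathlib.Tactic.Linarith
import Mathlib.Tactic.Ring
import HarnessLib

/-!
# `NoHeavyLowerTail` (crux stmt-CriticalPhenomena-4575), master-family line P1: the co-sunflower class law is CLOSED UNDER
# DISJUNCTION OF THE THIRD GENERATOR WITH A COORDINATE — at a SHARED coordinate, with an exact one-coordinate identity

Support file (seat `prim-masterthm-p1`, gen 9; `--supports stmt-CriticalPhenomena-4575`).  No definition, no `sorry`, standard axioms.
Memo `run/shared/lean/prim/prim-masterthm/FROM-prim-masterthm-p1-g9-CLAUSE-CLOSURE.md`.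

CONTEXT.  Sahi's `C_3` on the CO-SUNFLOWER class `U = (G₂ ∪ G₃, G₁ ∪ G₃, G₁ ∪ G₂)` (`G_i` increasing; = Kahn's Conjecture 5 on the
complements of a three-petal sunflower of increasing events, the tree's `(1 + a)(ab − e₂) ≥ e₃`) is OPEN.  Proved strata so far
(`…SahiCoSunflowerOrCoordinate`, `…PrivateCoordinate`, `…Cylinder`, `SahiPairInter`, `SunflowerPartition`): one generator a cylinder /
an OR-clause / independent, a PRIVATE coordinate glued into `G₃`, principal and two-generator cores.  Gen 8 showed numerically that NO
one-coordinate law of the class is Harris-certifiable at a general shared coordinate (LP pseudo-points).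

THIS FILE: at a coordinate `e` that enters `G₃` as a DISJUNCT — `G₃ = {e ∈ ω} ∪ H`, `H` arbitrary increasing, and `G₁ = A`, `G₂ = B`
ARBITRARY increasing events that MAY DEPEND ON `e` — the fibre cubic `f(t) = E_3(μ_p; B ∪ G₃, A ∪ G₃, A ∪ B)` (`t = p_e`) satisfies the
EXACT IDENTITY (`or_fibre_identity`, sections `X⁰ = X^{e←0}`, `X¹ = X^{e←1}`, `P = A⁰ ∪ H⁰`, `Q = B⁰ ∪ H⁰`, `W⁰ = A⁰ ∪ B⁰`, `W¹ = A¹ ∪ B¹`)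
  `f(t) = (1−t)²·E_3(μ_p; Q, P, W⁰) + t(1−t)·[ (μ(P∩Q∩W⁰) − μ(W⁰)μ(P∩Q)) + (1 − μ(P∩Q))(μ(W¹) − μ(W⁰)) ]
          + t(1−t)²·(1 − μ(P))(1 − μ(Q))(μ(W¹) − μ(W⁰))`,
i.e. in Bernstein form `B₀ = E_3(Q,P,W⁰)`, `3B₂ = Cov(W⁰, P∩Q) + (1 − μ(P∩Q))(μ(W¹) − μ(W⁰)) ≥ 0`,
`3B₁ = B₀ + 3B₂ + (1−μ(P))(1−μ(Q))(μ(W¹)−μ(W⁰))`, `B₃ = 0` — every term but `B₀` is nonnegative by HARRIS for the increasing pair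
`(W⁰, P∩Q)` and `W⁰ ⊆ W¹`.  Hence (`sahiE_three_orClosure_ge`)
  `E_3(μ_p; B ∪ {e∈ω} ∪ H, A ∪ {e∈ω} ∪ H, A ∪ B) ≥ (1 − p_e)² · E_3(μ_p; B⁰ ∪ H⁰, A⁰ ∪ H⁰, A⁰ ∪ B⁰)`,
the right-hand side being the class functional of the increasing triple `(A⁰, B⁰, H⁰)`.  COROLLARIES: the set of "good third generators"
`𝒢 = {G₃ : ∀ increasing G₁ G₂, 0 ≤ E_3(G₂∪G₃, G₁∪G₃, G₁∪G₂)}` is closed under `H ↦ {e∈ω} ∪ H` for every coordinate `e` not used by `H`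
(`good_orCoord`), hence under `H ↦ O_S ∪ H` for every finite `S` of fresh coordinates (`good_orCylinder`); with `H = ∅` (good by
Harris, `sahiE_three_pair_pairUnion_nonneg`) this re-proves gen 8's OR-clause / cylinder theorem by induction instead of Blinovsky.
The companion AND-closure (`G₃ = {e∈ω} ∩ K`, e shared) holds too but its certificate is not a two-term identity (memo §2); it is the
subject of the sibling file `…SahiCoSunflowerAndClosure`.
HONEST FRAMING: closure theorems for the class; the class law itself and Kahn's Conjecture 5 remain OPEN. [this work]
-/

noncomputable section

open scoped Classical

namespace Summit.CriticalPhenomena.PercolationContinuityZ3.Theorems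

namespace SahiCoSunflowerOrClosure

open Finset Function
open Literature.Combinatorics.Sahi2008
open Literature.Probability.LatticeModels (sahiE3 prodBernoulli)
open Literature.Probability.Percolation.DecisionTree (ind ind_of_mem ind_of_not_mem ind_nonneg)

variable {ι : Type} [Fintype ι]

local notation3 (prettyPrint := false) "m⟦" p ", " X "⟧" => ex (bernoulliWeight p) (ind X)

/-! ### 1. The one-variable identity and its sign -/

/-- **The fibre identity at an OR-coordinate** (pure algebra).  With the inclusion–exclusion relations of the level-`0` moments
`pq = p + q − z`, `qw = q + w − z`, `pw = p + w − z`, `pqw = pq + w − z` (`z = μ(A⁰ ∪ B⁰ ∪ H⁰)`), Sahi's `E_3` of the three affine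
section-mixtures equals `(1−t)²·B₀ + t(1−t)·3B₂ + t(1−t)²·(1−p)(1−q)(w₁−w)`. [this work] -/
theorem or_fibre_identity {t q p w z w₁ pq qw pw pqw : ℝ} (hpq : pq = p + q - z) (hqw : qw = q + w - z)
    (hpw : pw = p + w - z) (hpqw : pqw = pq + w - z) :
    2 * (t * w₁ + (1 - t) * pqw) + (t + (1 - t) * q) * (t + (1 - t) * p) * (t * w₁ + (1 - t) * w)
        - ((t + (1 - t) * q) * (t * w₁ + (1 - t) * pw) + (t + (1 - t) * p) * (t * w₁ + (1 - t) * qw)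
          + (t * w₁ + (1 - t) * w) * (t + (1 - t) * pq)) =
      (1 - t) ^ 2 * (2 * pqw + q * p * w - (q * pw + p * qw + w * pq))
        + t * (1 - t) * ((pqw - w * pq) + (1 - pq) * (w₁ - w))
        + t * (1 - t) ^ 2 * ((1 - p) * (1 - q) * (w₁ - w)) := by
  subst hpqw hqw hpw
  subst hpq
  ring

/-- **Sign of the identity**: with `t ∈ [0,1]`, `p, q, pq ≤ 1`, `w ≤ w₁` and Harris `w·pq ≤ pqw`, the fibre dominates `(1−t)²·B₀`. [this work] -/
theorem or_fibre_ge {t q p w z w₁ pq qw pw pqw : ℝ} (hpq : pq = p + q - z) (hqw : qw = q + w - z)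
    (hpw : pw = p + w - z) (hpqw : pqw = pq + w - z) (ht0 : 0 ≤ t) (ht1 : t ≤ 1) (hp1 : p ≤ 1) (hq1 : q ≤ 1)
    (hpq1 : pq ≤ 1) (hw : w ≤ w₁) (hH : w * pq ≤ pqw) :
    (1 - t) ^ 2 * (2 * pqw + q * p * w - (q * pw + p * qw + w * pq)) ≤
      2 * (t * w₁ + (1 - t) * pqw) + (t + (1 - t) * q) * (t + (1 - t) * p) * (t * w₁ + (1 - t) * w)
        - ((t + (1 - t) * q) * (t * w₁ + (1 - t) * pw) + (t + (1 - t) * p) * (t * w₁ + (1 - t) * qw)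
          + (t * w₁ + (1 - t) * w) * (t + (1 - t) * pq)) := by
  rw [or_fibre_identity hpq hqw hpw hpqw]
  have h1 : 0 ≤ t * (1 - t) * ((pqw - w * pq) + (1 - pq) * (w₁ - w)) :=
    mul_nonneg (mul_nonneg ht0 (sub_nonneg.2 ht1))
      (add_nonneg (sub_nonneg.2 hH) (mul_nonneg (sub_nonneg.2 hpq1) (sub_nonneg.2 hw)))
  have h2 : 0 ≤ t * (1 - t) ^ 2 * ((1 - p) * (1 - q) * (w₁ - w)) :=
    mul_nonneg (mul_nonneg ht0 (pow_nonneg (sub_nonneg.2 ht1) 2))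
      (mul_nonneg (mul_nonneg (sub_nonneg.2 hp1) (sub_nonneg.2 hq1)) (sub_nonneg.2 hw))
  linarith

/-! ### 2. Sections of the three events at an OR-coordinate -/

omit [Fintype ι] in
/-- Sections of `X ∪ ({e ∈ ω} ∪ H)`: everything on top, `X⁰ ∪ H⁰` at the bottom. [folklore] -/
theorem secAt_union_orCoord (e : ι) (X H : Set (Set ι)) :
    secAt e true (X ∪ ({ω : Set ι | e ∈ ω} ∪ H)) = Set.univ ∧
      secAt e false (X ∪ ({ω : Set ι | e ∈ ω} ∪ H)) = secAt e false X ∪ secAt e false H := by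
  constructor
  · rw [SahiCombDisjunct.secAt_union, SahiCombDisjunct.secAt_union, SahiCombDisjunct.secAt_true_coord, Set.univ_union,
      Set.union_univ]
  · rw [SahiCombDisjunct.secAt_union, SahiCombDisjunct.secAt_union, SahiCombDisjunct.secAt_false_coord, Set.empty_union]

/-! ### 3. The theorem -/

/-- **THEOREM (OR-coordinate domination, `e` shared).**  For every finite cube, product weight `p`, coordinate `e` and ALL increasing
`A, B, H` (they may depend on `e`):
`(1 − p_e)² · E_3(μ_p; B⁰ ∪ H⁰, A⁰ ∪ H⁰, A⁰ ∪ B⁰) ≤ E_3(μ_p; B ∪ ({e∈ω} ∪ H), A ∪ ({e∈ω} ∪ H), A ∪ B)`,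
where `X⁰ = X^{e←0}` are the `0`-sections (increasing events ignoring `e`; the left `E_3` is the class functional of `(A⁰, B⁰, H⁰)`).
Proof: condition on `e` (`ex_ind_eq_secAt`), `or_fibre_ge` with Harris for `(A⁰∪B⁰, (A⁰∪H⁰)∩(B⁰∪H⁰))` and `μ(A⁰∪B⁰) ≤ μ(A¹∪B¹)`. [this work] -/
theorem sahiE_three_orClosure_ge (p : ι → unitInterval) (e : ι) {A B H : Set (Set ι)} (hA : IsUpperSet A) (hB : IsUpperSet B)
    (hH : IsUpperSet H) :
    (1 - (p e : ℝ)) ^ 2 * sahiE (bernoulliWeight p) 3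
        ![ind (secAt e false B ∪ secAt e false H), ind (secAt e false A ∪ secAt e false H), ind (secAt e false A ∪ secAt e false B)]
      ≤ sahiE (bernoulliWeight p) 3
        ![ind (B ∪ ({ω : Set ι | e ∈ ω} ∪ H)), ind (A ∪ ({ω : Set ι | e ∈ ω} ∪ H)), ind (A ∪ B)] := by
  set G : Set (Set ι) := {ω : Set ι | e ∈ ω} ∪ H with hG
  set A0 := secAt e false A
  set B0 := secAt e false B
  set H0 := secAt e false H
  set A1 := secAt e true A
  set B1 := secAt e true B
  set t : ℝ := (p e : ℝ) with ht
  set μ := bernoulliWeight p with hμ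
  have ht0 : 0 ≤ t := (p e).2.1
  have ht1 : t ≤ 1 := (p e).2.2
  obtain ⟨sB1, sB0⟩ := secAt_union_orCoord e B H
  obtain ⟨sA1, sA0⟩ := secAt_union_orCoord e A H
  -- the seven moments of the big functional, conditioned on `e`
  have e1 : ex μ (ind (B ∪ G)) = t + (1 - t) * ex μ (ind (B0 ∪ H0)) := by
    rw [ex_ind_eq_secAt p e, sB1, sB0, SahiCombDisjunct.ex_ind_univ, mul_one]
  have e2 : ex μ (ind (A ∪ G)) = t + (1 - t) * ex μ (ind (A0 ∪ H0)) := by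
    rw [ex_ind_eq_secAt p e, sA1, sA0, SahiCombDisjunct.ex_ind_univ, mul_one]
  have e3 : ex μ (ind (A ∪ B)) = t * ex μ (ind (A1 ∪ B1)) + (1 - t) * ex μ (ind (A0 ∪ B0)) := by
    rw [ex_ind_eq_secAt p e, SahiCombDisjunct.secAt_union, SahiCombDisjunct.secAt_union]
  have e12 : ex μ (ind ((B ∪ G) ∩ (A ∪ G))) = t + (1 - t) * ex μ (ind ((B0 ∪ H0) ∩ (A0 ∪ H0))) := by
    rw [ex_ind_eq_secAt p e, secAt_inter, secAt_inter, sB1, sB0, sA1, sA0, Set.univ_inter, SahiCombDisjunct.ex_ind_univ, mul_one]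
  have e13 : ex μ (ind ((B ∪ G) ∩ (A ∪ B))) =
      t * ex μ (ind (A1 ∪ B1)) + (1 - t) * ex μ (ind ((B0 ∪ H0) ∩ (A0 ∪ B0))) := by
    rw [ex_ind_eq_secAt p e, secAt_inter, secAt_inter, sB1, sB0, SahiCombDisjunct.secAt_union, SahiCombDisjunct.secAt_union,
      Set.univ_inter]
  have e23 : ex μ (ind ((A ∪ G) ∩ (A ∪ B))) =
      t * ex μ (ind (A1 ∪ B1)) + (1 - t) * ex μ (ind ((A0 ∪ H0) ∩ (A0 ∪ B0))) := by
    rw [ex_ind_eq_secAt p e, secAt_inter, secAt_inter, sA1, sA0, SahiCombDisjunct.secAt_union, SahiCombDisjunct.secAt_union,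
      Set.univ_inter]
  have e123 : ex μ (ind ((B ∪ G) ∩ (A ∪ G) ∩ (A ∪ B))) =
      t * ex μ (ind (A1 ∪ B1)) + (1 - t) * ex μ (ind ((B0 ∪ H0) ∩ (A0 ∪ H0) ∩ (A0 ∪ B0))) := by
    rw [ex_ind_eq_secAt p e, secAt_inter, secAt_inter, secAt_inter, secAt_inter, sB1, sB0, sA1, sA0,
      SahiCombDisjunct.secAt_union, SahiCombDisjunct.secAt_union, Set.univ_inter, Set.univ_inter]
  -- inclusion–exclusion among the level-0 moments: all four unions are `Z = A0 ∪ B0 ∪ H0`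
  set Z : Set (Set ι) := A0 ∪ B0 ∪ H0 with hZ
  have u1 : (B0 ∪ H0) ∪ (A0 ∪ H0) = Z := Set.ext fun ω => by simp only [Set.mem_union, hZ]; tauto
  have u2 : (B0 ∪ H0) ∪ (A0 ∪ B0) = Z := Set.ext fun ω => by simp only [Set.mem_union, hZ]; tauto
  have u3 : (A0 ∪ H0) ∪ (A0 ∪ B0) = Z := Set.ext fun ω => by simp only [Set.mem_union, hZ]; tauto
  have u4 : ((B0 ∪ H0) ∩ (A0 ∪ H0)) ∪ (A0 ∪ B0) = Z :=
    Set.ext fun ω => by simp only [Set.mem_union, Set.mem_inter_iff, hZ]; tauto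
  have hpq : ex μ (ind ((B0 ∪ H0) ∩ (A0 ∪ H0))) = ex μ (ind (A0 ∪ H0)) + ex μ (ind (B0 ∪ H0)) - ex μ (ind Z) := by
    have h := SahiCoSunflowerOrCoordinate.ex_ind_union μ (B0 ∪ H0) (A0 ∪ H0); rw [u1] at h; linarith
  have hqw : ex μ (ind ((B0 ∪ H0) ∩ (A0 ∪ B0))) = ex μ (ind (B0 ∪ H0)) + ex μ (ind (A0 ∪ B0)) - ex μ (ind Z) := by
    have h := SahiCoSunflowerOrCoordinate.ex_ind_union μ (B0 ∪ H0) (A0 ∪ B0); rw [u2] at h; linarith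
  have hpw : ex μ (ind ((A0 ∪ H0) ∩ (A0 ∪ B0))) = ex μ (ind (A0 ∪ H0)) + ex μ (ind (A0 ∪ B0)) - ex μ (ind Z) := by
    have h := SahiCoSunflowerOrCoordinate.ex_ind_union μ (A0 ∪ H0) (A0 ∪ B0); rw [u3] at h; linarith
  have hpqw : ex μ (ind ((B0 ∪ H0) ∩ (A0 ∪ H0) ∩ (A0 ∪ B0))) =
      ex μ (ind ((B0 ∪ H0) ∩ (A0 ∪ H0))) + ex μ (ind (A0 ∪ B0)) - ex μ (ind Z) := by
    have h := SahiCoSunflowerOrCoordinate.ex_ind_union μ ((B0 ∪ H0) ∩ (A0 ∪ H0)) (A0 ∪ B0); rw [u4] at h; linarith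
  -- the ingredients: sections are increasing, Harris, monotonicity, masses ≤ 1
  have hA0 : IsUpperSet A0 := isUpperSet_secAt e false hA
  have hB0 : IsUpperSet B0 := isUpperSet_secAt e false hB
  have hH0 : IsUpperSet H0 := isUpperSet_secAt e false hH
  have hHar : ex μ (ind (A0 ∪ B0)) * ex μ (ind ((B0 ∪ H0) ∩ (A0 ∪ H0))) ≤
      ex μ (ind ((B0 ∪ H0) ∩ (A0 ∪ H0) ∩ (A0 ∪ B0))) := by
    have hPQ : IsUpperSet ((B0 ∪ H0) ∩ (A0 ∪ H0)) := IsUpperSet.inter (hB0.union hH0) (hA0.union hH0)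
    have h := harris_ex_ind p (hA0.union hB0) hPQ
    rwa [Set.inter_comm (A0 ∪ B0) ((B0 ∪ H0) ∩ (A0 ∪ H0))] at h
  have hw : ex μ (ind (A0 ∪ B0)) ≤ ex μ (ind (A1 ∪ B1)) := by
    have h := Pointwise.ex_secAt_true_sub_false_nonneg p e (hA.union hB)
    rw [SahiCombDisjunct.secAt_union, SahiCombDisjunct.secAt_union] at h
    linarith
  -- assemble
  rw [sahiE_three, sahiE_three]
  simp only [ind_mul_ind_eq_inter]
  rw [e1, e2, e3, e12, e13, e23, e123]
  exact or_fibre_ge hpq hqw hpw hpqw ht0 ht1 (ex_bernoulliWeight_ind_le_one p _) (ex_bernoulliWeight_ind_le_one p _)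
    (ex_bernoulliWeight_ind_le_one p _) hw hHar

/-- **OR-closure of the class law at a shared coordinate.**  If the co-sunflower triple of the `0`-sections `(A⁰, B⁰, H⁰)` satisfies
Sahi's `C_3`, so does the triple of `(A, B, {e∈ω} ∪ H)`. [this work] -/
theorem sahiE_three_orClosure_nonneg (p : ι → unitInterval) (e : ι) {A B H : Set (Set ι)} (hA : IsUpperSet A) (hB : IsUpperSet B)
    (hH : IsUpperSet H)
    (h0 : 0 ≤ sahiE (bernoulliWeight p) 3
      ![ind (secAt e false B ∪ secAt e false H), ind (secAt e false A ∪ secAt e false H), ind (secAt e false A ∪ secAt e false B)]) :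
    0 ≤ sahiE (bernoulliWeight p) 3 ![ind (B ∪ ({ω : Set ι | e ∈ ω} ∪ H)), ind (A ∪ ({ω : Set ι | e ∈ ω} ∪ H)), ind (A ∪ B)] :=
  le_trans (mul_nonneg (pow_nonneg (sub_nonneg.2 (p e).2.2) 2) h0) (sahiE_three_orClosure_ge p e hA hB hH)

/-! ### 4. Good third generators: closure under OR-ing fresh coordinates, and the OR-clause theorem re-derived -/

/-- **Closure of the GOOD third generators under `H ↦ {e∈ω} ∪ H` (`e` fresh for `H`, arbitrary for `G₁, G₂`).**  If `H` ignores `e` and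
`0 ≤ E_3(μ_p; G₂ ∪ H, G₁ ∪ H, G₁ ∪ G₂)` for ALL increasing `G₁, G₂`, then the same holds for `{e∈ω} ∪ H`. [this work] -/
theorem good_orCoord (p : ι → unitInterval) (e : ι) {H : Set (Set ι)} (hH : IsUpperSet H) (hHe : secAt e false H = H)
    (hgood : ∀ G₁ G₂ : Set (Set ι), IsUpperSet G₁ → IsUpperSet G₂ →
      0 ≤ sahiE (bernoulliWeight p) 3 ![ind (G₂ ∪ H), ind (G₁ ∪ H), ind (G₁ ∪ G₂)]) :
    ∀ G₁ G₂ : Set (Set ι), IsUpperSet G₁ → IsUpperSet G₂ →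
      0 ≤ sahiE (bernoulliWeight p) 3 ![ind (G₂ ∪ ({ω : Set ι | e ∈ ω} ∪ H)), ind (G₁ ∪ ({ω : Set ι | e ∈ ω} ∪ H)), ind (G₁ ∪ G₂)] := by
  intro G₁ G₂ h₁ h₂
  refine sahiE_three_orClosure_nonneg p e h₁ h₂ hH ?_
  rw [hHe]
  exact hgood _ _ (isUpperSet_secAt e false h₁) (isUpperSet_secAt e false h₂)

omit [Fintype ι] in
/-- The OR-clause `O_S = {ω | ∃ e ∈ S, e ∈ ω}` of a finite set of coordinates ignores every other coordinate. [folklore] -/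
theorem secAt_orClause_of_not_mem {S : Finset ι} {e : ι} (he : e ∉ S) (b : Bool) :
    secAt e b {ω : Set ι | ∃ f ∈ S, f ∈ ω} = {ω : Set ι | ∃ f ∈ S, f ∈ ω} := by
  ext ω
  rw [mem_secAt]
  simp only [Set.mem_setOf_eq]
  cases b
  · simp only [forceAt, cond_false, Set.mem_sdiff, Set.mem_singleton_iff]
    constructor
    · rintro ⟨f, hf, hfω, -⟩; exact ⟨f, hf, hfω⟩
    · rintro ⟨f, hf, hfω⟩; exact ⟨f, hf, hfω, fun h => he (h ▸ hf)⟩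
  · simp only [forceAt, cond_true, Set.mem_insert_iff]
    constructor
    · rintro ⟨f, hf, rfl | hfω⟩
      · exact absurd hf he
      · exact ⟨f, hf, hfω⟩
    · rintro ⟨f, hf, hfω⟩; exact ⟨f, hf, Or.inr hfω⟩

omit [Fintype ι] in
/-- `O_{insert e S} = {e ∈ ω} ∪ O_S`. [folklore] -/
theorem orClause_insert (S : Finset ι) (e : ι) :
    {ω : Set ι | ∃ f ∈ insert e S, f ∈ ω} = {ω : Set ι | e ∈ ω} ∪ {ω : Set ι | ∃ f ∈ S, f ∈ ω} := by
  ext ω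
  simp only [Set.mem_setOf_eq, Finset.mem_insert, Set.mem_union]
  constructor
  · rintro ⟨f, rfl | hf, hfω⟩
    · exact Or.inl hfω
    · exact Or.inr ⟨f, hf, hfω⟩
  · rintro (h | ⟨f, hf, hfω⟩)
    · exact ⟨e, Or.inl rfl, h⟩
    · exact ⟨f, Or.inr hf, hfω⟩

omit [Fintype ι] in
/-- The OR-clause of a finite set of coordinates is increasing. [folklore] -/
theorem isUpperSet_orClause (S : Finset ι) : IsUpperSet {ω : Set ι | ∃ f ∈ S, f ∈ ω} := by
  intro ω ω' hle
  rintro ⟨f, hf, hfω⟩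
  exact ⟨f, hf, hle hfω⟩

/-- **Closure under OR-ing a whole clause of fresh coordinates.**  If `H` ignores every coordinate of `S` and is a good third generator,
so is `O_S ∪ H`, `O_S = {ω | ∃ e ∈ S, e ∈ ω}` (induction on `S` with `good_orCoord`). [this work] -/
theorem good_orClause (p : ι → unitInterval) (S : Finset ι) {H : Set (Set ι)} (hH : IsUpperSet H)
    (hHS : ∀ e ∈ S, ∀ b, secAt e b H = H)
    (hgood : ∀ G₁ G₂ : Set (Set ι), IsUpperSet G₁ → IsUpperSet G₂ →
      0 ≤ sahiE (bernoulliWeight p) 3 ![ind (G₂ ∪ H), ind (G₁ ∪ H), ind (G₁ ∪ G₂)]) :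
    ∀ G₁ G₂ : Set (Set ι), IsUpperSet G₁ → IsUpperSet G₂ →
      0 ≤ sahiE (bernoulliWeight p) 3
        ![ind (G₂ ∪ ({ω : Set ι | ∃ e ∈ S, e ∈ ω} ∪ H)), ind (G₁ ∪ ({ω : Set ι | ∃ e ∈ S, e ∈ ω} ∪ H)), ind (G₁ ∪ G₂)] := by
  induction S using Finset.induction_on with
  | empty =>
    intro G₁ G₂ h₁ h₂
    have h0 : ({ω : Set ι | ∃ e ∈ (∅ : Finset ι), e ∈ ω} ∪ H) = H := by
      ext ω; simp
    rw [h0]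
    exact hgood G₁ G₂ h₁ h₂
  | @insert e S he ih =>
    intro G₁ G₂ h₁ h₂
    have hS : ∀ f ∈ S, ∀ b, secAt f b H = H := fun f hf b => hHS f (Finset.mem_insert_of_mem hf) b
    have hrec := ih hS
    have hset : ({ω : Set ι | ∃ f ∈ insert e S, f ∈ ω} ∪ H) =
        {ω : Set ι | e ∈ ω} ∪ ({ω : Set ι | ∃ f ∈ S, f ∈ ω} ∪ H) := by
      rw [orClause_insert, Set.union_assoc]
    rw [hset]
    refine good_orCoord p e ((isUpperSet_orClause S).union hH) ?_ hrec G₁ G₂ h₁ h₂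
    rw [SahiCombDisjunct.secAt_union, secAt_orClause_of_not_mem he, hHS e (Finset.mem_insert_self e S)]

/-- **Gen 8's OR-clause theorem re-derived by induction** (no Blinovsky): for every finite set of coordinates `S` and ALL increasing
`G₁, G₂`, `0 ≤ E_3(μ_p; G₂ ∪ O_S, G₁ ∪ O_S, G₁ ∪ G₂)` — base `H = ∅` (`E_3(G₂, G₁, G₁∪G₂) = (2 − w)Cov ≥ 0`, Harris). [this work] -/
theorem sahiE_three_orClause_nonneg' (p : ι → unitInterval) (S : Finset ι) {G₁ G₂ : Set (Set ι)} (h₁ : IsUpperSet G₁)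
    (h₂ : IsUpperSet G₂) :
    0 ≤ sahiE (bernoulliWeight p) 3
      ![ind (G₂ ∪ {ω : Set ι | ∃ e ∈ S, e ∈ ω}), ind (G₁ ∪ {ω : Set ι | ∃ e ∈ S, e ∈ ω}), ind (G₁ ∪ G₂)] := by
  have h := good_orClause p S (H := (∅ : Set (Set ι))) isUpperSet_empty
    (fun e _ b => by cases b <;> rfl)
    (fun G₁ G₂ h₁ h₂ => by
      rw [Set.union_empty, Set.union_empty]
      exact SahiCoSunflowerPrivate.sahiE_three_pair_pairUnion_nonneg p h₁ h₂) G₁ G₂ h₁ h₂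
  simpa only [Set.union_empty] using h

end SahiCoSunflowerOrClosure

end Summit.CriticalPhenomena.PercolationContinuityZ3.Theorems
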